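/-
Copyright (c) 2026 the pub-hodgecm-mathlib formalisation cell (harness21).  Prover seat hodgecm-mathlib-LH4-p11 (g0), req620 Track A «(D-RAM) FOUR-FRAME» squad
(heir LEAD F0P3a-plan (g19) «FOUR-FRAME SKELETON LANDED» EMIT #8; dealer LH4-plan (g10)).  2026-09-03.
-/
import Summits.HodgeConjecture.HodgeConjecture.Theorems.F0P3cDyRamU3EdgeLawT2          -- ★ p854902 (LH4-p09): `exists_unimodular_diagonal_model_frameElt` pattern; brings ★ #0a `UnitaryThreeFourFrameDefs`, ★ `…LiteralUnitary`
import Literature.NumberTheory.Automorphic.UnitaryLatticeTreeFormTransport                -- ★ `isVertexLattice_formCongr_iff`, `mapGL_conj_mapGL_eq_iff`, `mapGL_inv_mapGL`, `isVertexLattice_smul_iff`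
import HarnessLib

/-!
# Crux `H413`, line LH4 «(D-RAM) FOUR-FRAME» road — unit U3_Laws (iii), TIER 2 SUPPORT: THE FOUR-FRAME FIXED-VERTEX CENSUS IN THE UNIMODULAR DIAGONAL MODEL
# (steps (1)–(2) of the (S) reduction, for BOTH vertex types; serves `stub_U3_stableLaw_RP` and `stub_U3_stableLaw_RU` alike)

Cell `hodgecm-mathlib` (D-0151), FLOOR 0, crux item H413 = `stmt-HodgeConjecture-24833`, route of record `HCCMUnconditional`; squad F0∕P3c∕LH4 (req618∕req620).  THEOREMS ONLY
(no `def`, no instance, no notation, no `sorry`, default heartbeats); lane `--supports stmt-HodgeConjecture-24833 --as helper` (count-neutral).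

WHAT IS PROVED.  The census function `fixedVertexCount σ ϖ t Γ` (★ #0a H2: the number of type-`t` vertex lattices of `(K³, Φ₃)` fixed by `Γ`) of a frame element
`Γ_b = frameElt σ f b α β` is computed in the UNIMODULAR DIAGONAL MODEL of the frame: there is a unit diagonal form `h_d = diag(d₁, d₂, d₃)` (`|d_i| = 1`, `σ d_i = d_i`,
`d_i` in the norm class of `N(f_i^{(b)})`) with  `fixedVertexCount σ ϖ t Γ_b = #{M : M a type-t vertex lattice of (K³, h_d), diag(α, β, 1)·M = M}`  for BOTH `t = 0, 2`
(`fixedVertexCount_frameElt_eq_ncard_diagonal_model`); and the model count depends on `d` only through a common unit scalar (`ncard_fixed_diagonal_smul_eq`) and through the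
classes `d_i · N(E^×)` (`ncard_fixed_diagonal_eq_of_exists_norm`).  These are steps (1) («form transport + frame rescaling: `n_t(γ_b) = C_t(ε(b))`») and (2) («global unit
scaling: `C_t(ε) = C_t(c·ε)`») of the frame-free reformulation of the STABLE LAW (S) (LH4-p10 (g0) REPORT 1 ∕ LH4-p11 (g0) DATUM §4, 2026-09-03), typed once for both heads.

THE MATHEMATICS ([BruhatTits1972, §10]; [Jacobowitz1962, §4]; [Rogawski1990, §4.9 p. 55]).  (T) For any `P, T ∈ GL_N(K)` the map `M ↦ P·M` is a bijection from the type-`t`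
vertex lattices of the congruent form `ᵗσ(P)·H·P` fixed by `T` onto the type-`t` vertex lattices of `H` fixed by `P T P⁻¹` (★ `isVertexLattice_formCongr_iff`,
★ `mapGL_conj_mapGL_eq_iff`), so the two fixed counts (`Set.ncard`) agree; a unit scalar `c` of the form changes nothing (★ `isVertexLattice_smul_iff`).  (F) Every norm
`N_i = Φ₃(f_i, f_i)` of a four-frame is `σ`-fixed and non-zero, hence of EVEN valuation `2n_i` (datum clause (4)); the rescaled frame `A = Q_b·diag(ϖ^{n_i})` has
`ᵗσ(A)·Φ₃·A = diag(d)`, `d_i = σ(ϖ^{n_i})·N_i·ϖ^{n_i} = N_i · N_{E∕F}(ϖ^{n_i})` (a unit, `σ`-fixed, in the norm class of `N_i`), and `Γ_b = A·diag(α, β, 1)·A⁻¹`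
(the proof of ★ p854902 `exists_unimodular_diagonal_model_frameElt`, re-run with `d` kept explicit).  (C) Two unit diagonal forms whose entries differ by norms
`σ(z_i) z_i` are congruent by the diagonal matrix `diag(z)`, which commutes with `diag(α, β, 1)`.
* §1 `ncard_fixed_formCongr_eq` (T), `ncard_fixed_smul_form_eq`, `ncard_fixed_diagonal_smul_eq` (unit scalar).
* §2 `exists_mul_map_eq_mul_norm_iff`, `normSign_mul_norm` (`ω(x·zσz) = ω(x)`).
* §3 `exists_unimodular_diagonal_frame` (F, explicit `d`), the head `fixedVertexCount_frameElt_eq_ncard_diagonal_model`.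
* §4 `ncard_fixed_diagonal_eq_of_exists_norm` (C).
HONEST LABEL.  Count-neutral (`--supports`); nothing printed is asserted; the census laws stay PROVER TARGETS; the verdict of record for (D-RAM) stays PRINT
[LanglandsShelstad1989 Thm. p. 484 ∕ Rogawski1990 Prop. 4.9.1 (a)] ∕ XL; `HC_CM` is proved only modulo the 7 printed citations (2 remaining named inputs: hLiu418 =
`stmt-HodgeConjecture-24832`, h413 = `stmt-HodgeConjecture-24833`) until rung 0 closes.

## References
* [BruhatTits1972] F. Bruhat, J. Tits, *Groupes réductifs sur un corps local I*, Publ. Math. IHÉS 41 (1972), §10 (lattice models of the building of a unitary group).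
* [Jacobowitz1962] R. Jacobowitz, *Hermitian forms over local fields*, Amer. J. Math. 84 (1962), §4 (Gram matrices, scaling, norm classes).
* [Rogawski1990] J. D. Rogawski, *Automorphic Representations of Unitary Groups in Three Variables*, Ann. of Math. Stud. 123 (1990), §3.6 pp. 28–29 (elliptic tori and frames), §4.9 Prop. 4.9.1 (a) p. 55 (orbital integrals as fixed-lattice counts).
* [Kottwitz1986BaseChangeUnits] R. E. Kottwitz, *Base change for unit elements of Hecke algebras*, Compositio Math. 60 (1986), §1 pp. 240–241 (fixed-lattice counting).
-/

set_option autoImplicit false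

noncomputable section

namespace Summit.HodgeConjecture.HodgeConjecture.Cruxes.H413.F0P3cDyRamFixedCountDiagonalModel

open Matrix
open Literature.NumberTheory.Automorphic Literature.NumberTheory.Automorphic.HermitianLattice Literature.NumberTheory.Automorphic.UnitaryGroup
open Literature.NumberTheory.Automorphic.UnitaryLatticeTree Literature.NumberTheory.Automorphic.UnitaryThreeFourFrame
open scoped Valued WithZero Matrix MatrixGroups

/-! ## §1  Form transport of the type-`t` fixed count, and unit scalars -/

section Transport

variable {K : Type*} [Field K] [Valued K ℤᵐ⁰] {N : ℕ}

/-- **(T) FORM TRANSPORT OF THE FIXED COUNT.**  For `P, T ∈ GL_N(K)`, the type-`t` vertex lattices of the congruent form `ᵗσ(P)·H·P` fixed by `T` are in bijection with the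
type-`t` vertex lattices of `H` fixed by `P·T·P⁻¹`, by `M ↦ P·M` (★ `isVertexLattice_formCongr_iff`, ★ `mapGL_conj_mapGL_eq_iff`); hence the two fixed counts agree.
[cite: BruhatTits1972, §10] [cite: Kottwitz1986BaseChangeUnits, §1 pp. 240–241] -/
theorem ncard_fixed_formCongr_eq (σ : K →+* K) (ϖ : K) (H : Matrix (Fin N) (Fin N) K) (P T : GL (Fin N) K) (t : ℕ) :
    {M : Submodule 𝒪[K] (Fin N → K) | IsVertexLattice σ ϖ (formCongr σ P H) t M ∧ mapGL T M = M}.ncard =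
      {M : Submodule 𝒪[K] (Fin N → K) | IsVertexLattice σ ϖ H t M ∧ mapGL (P * T * P⁻¹) M = M}.ncard := by
  refine Set.ncard_congr (fun M _ => mapGL P M) (fun M hM => ?_) (fun M M' _ _ h => ?_) (fun M' hM' => ?_)
  · rw [Set.mem_setOf_eq] at hM ⊢
    exact ⟨(isVertexLattice_formCongr_iff (σ := σ) (ϖ := ϖ) P H t M).1 hM.1, (mapGL_conj_mapGL_eq_iff P T M).2 hM.2⟩
  · simpa only [mapGL_inv_mapGL] using congrArg (mapGL P⁻¹) h
  · rw [Set.mem_setOf_eq] at hM'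
    refine ⟨mapGL P⁻¹ M', ?_, mapGL_mapGL_inv P M'⟩
    rw [Set.mem_setOf_eq]
    refine ⟨(isVertexLattice_formCongr_iff (σ := σ) (ϖ := ϖ) P H t _).2 (by rw [mapGL_mapGL_inv]; exact hM'.1), ?_⟩
    have h := (mapGL_conj_mapGL_eq_iff P T (mapGL P⁻¹ M')).1
    rw [mapGL_mapGL_inv] at h
    exact h hM'.2

/-- **UNIT SCALARS OF THE FORM DO NOT CHANGE THE FIXED COUNT**: `#{M : type t for c·H, T·M = M} = #{M : type t for H, T·M = M}` for `|c| = 1` (★ `isVertexLattice_smul_iff`).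
[cite: Jacobowitz1962, §4] -/
theorem ncard_fixed_smul_form_eq (σ : K →+* K) (ϖ : K) {c : K} (hc : Valued.v c = 1) (H : Matrix (Fin N) (Fin N) K) (T : GL (Fin N) K) (t : ℕ) :
    {M : Submodule 𝒪[K] (Fin N → K) | IsVertexLattice σ ϖ (c • H) t M ∧ mapGL T M = M}.ncard =
      {M : Submodule 𝒪[K] (Fin N → K) | IsVertexLattice σ ϖ H t M ∧ mapGL T M = M}.ncard := by
  simp only [isVertexLattice_smul_iff (σ := σ) (ϖ := ϖ) hc]

/-- Unit scalars, diagonal currency: `#{M : type t for diag(c·d), T·M = M} = #{M : type t for diag(d), T·M = M}` for `|c| = 1` — in the four-frame census this is the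
statement that the count attached to the sign classes `(ε₁, ε₂, ε₃)` equals the one attached to `(ω(c)ε₁, ω(c)ε₂, ω(c)ε₃)`. [cite: Jacobowitz1962, §4] -/
theorem ncard_fixed_diagonal_smul_eq (σ : K →+* K) (ϖ : K) {c : K} (hc : Valued.v c = 1) (d : Fin N → K) (T : GL (Fin N) K) (t : ℕ) :
    {M : Submodule 𝒪[K] (Fin N → K) | IsVertexLattice σ ϖ (Matrix.diagonal (c • d)) t M ∧ mapGL T M = M}.ncard =
      {M : Submodule 𝒪[K] (Fin N → K) | IsVertexLattice σ ϖ (Matrix.diagonal d) t M ∧ mapGL T M = M}.ncard := by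
  rw [Matrix.diagonal_smul]
  exact ncard_fixed_smul_form_eq σ ϖ hc _ T t

end Transport

/-! ## §2  Norm classes are stable under multiplication by norms -/

section NormSign

variable {K : Type} [Field K]

/-- `x·(z σz)` is of the form `w σw` iff `x` is (`z ≠ 0`). [cite: Jacobowitz1962, §4] -/
theorem exists_mul_map_eq_mul_norm_iff (σ : K →+* K) (x : K) {z : K} (hz : z ≠ 0) :
    (∃ w : K, w * σ w = x * (z * σ z)) ↔ ∃ w : K, w * σ w = x := by
  have hσz : σ z ≠ 0 := (map_ne_zero σ).2 hz
  constructor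
  · rintro ⟨w, hw⟩
    refine ⟨w / z, ?_⟩
    rw [map_div₀, div_mul_div_comm, hw, mul_div_assoc, div_self (mul_ne_zero hz hσz), mul_one]
  · rintro ⟨w, hw⟩
    exact ⟨w * z, by rw [map_mul, ← hw]; ring⟩

/-- **`ω(x · zσz) = ω(x)`**: the norm-class sign (★ #0a H1 `normSign`) is unchanged by a norm factor `z σz`, `z ≠ 0`. [cite: Jacobowitz1962, §4] [cite: Rogawski1990, §4.9 p. 55] -/
theorem normSign_mul_norm (σ : K →+* K) (x : K) {z : K} (hz : z ≠ 0) : normSign σ (x * (z * σ z)) = normSign σ x := by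
  unfold normSign
  by_cases h : ∃ w : K, w * σ w = x
  · rw [if_pos h, if_pos ((exists_mul_map_eq_mul_norm_iff σ x hz).2 h)]
  · rw [if_neg h, if_neg (mt (exists_mul_map_eq_mul_norm_iff σ x hz).1 h)]

end NormSign

/-! ## §3  The unimodular diagonal model of a four-frame (explicit `d`) and the head -/

section Frame

variable {K : Type} [Field K] [Valued K ℤᵐ⁰] {σ : K →+* K} {ϖ : K}

/-- **(F) THE RESCALED (UNIMODULAR) DIAGONAL MODEL OF A FOUR-FRAME, WITH ITS ENTRIES.**  For a four-frame family `f` (★ #0a H7) at a frame `b`, if every non-zero `σ`-fixed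
element has EVEN valuation (datum clause (4)), there are `A ∈ GL₃(K)` and `d` with: `|d_i| = 1`; `σ d_i = d_i`; `ω(d_i) = ω(N_i)` where `N_i = Φ₃(f_i, f_i)` (★ #0a H1);
`ᵗσ(A)·Φ₃·A = diag(d)`; and `frameElt σ f b α β = A·diag(α, β, 1)·A⁻¹` for all `α, β`.  Here `A = Q_b·diag(ϖ^{n_i})` and `d_i = σ(ϖ^{n_i})·N_i·ϖ^{n_i}`, `|N_i| = exp(2n_i)`
(the proof of ★ p854902 `exists_unimodular_diagonal_model_frameElt`, with `d` kept explicit; ★ `formCongr_frameMatrix`, ★ `frameElt_eq_conj_diagonal`, ★ `σ_pairing_eq`).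
[cite: BruhatTits1972, §10] [cite: Rogawski1990, §3.6 pp. 28–29] -/
theorem exists_unimodular_diagonal_frame (hσ : ∀ x, σ (σ x) = x) (hvσ : ∀ a, Valued.v (σ a) = Valued.v a) (hϖ : Valued.v ϖ = WithZero.exp (-1 : ℤ))
    (heven : ∀ x : K, σ x = x → x ≠ 0 → ∃ n : ℤ, Valued.v x = WithZero.exp (2 * n))
    {f : Fin 4 → Fin 3 → (Fin 3 → K)} (hf : IsFourFrameFamily σ f) (b : Fin 4) :
    ∃ (A : GL (Fin 3) K) (d : Fin 3 → K), (∀ i, Valued.v (d i) = 1) ∧ (∀ i, σ (d i) = d i) ∧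
      (∀ i, normSign σ (d i) = normSign σ (pairing σ ((StdForm.antidiagonal 3).over K) (f b i) (f b i))) ∧
      formCongr σ A ((StdForm.antidiagonal 3).over K) = Matrix.diagonal d ∧
      ∀ α β : K, frameElt σ f b α β = (A : Matrix (Fin 3) (Fin 3) K) * Matrix.diagonal ![α, β, 1] * ((A⁻¹ : GL (Fin 3) K) : Matrix (Fin 3) (Fin 3) K) := by
  classical
  have hϖ0 : ϖ ≠ 0 := CartanUnique.uniformizer_ne_zero hϖ
  have hHh : (((StdForm.antidiagonal 3).over K).map σ)ᵀ = (StdForm.antidiagonal 3).over K := by rw [StdForm.over_map, StdForm.transpose_over]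
  obtain ⟨-, hN0, -, -, -⟩ := hf b
  -- the norms `N_i = ⟨f_i, f_i⟩` are `σ`-fixed and non-zero, hence of even valuation `2 n_i`
  have hNσ : ∀ i : Fin 3, σ (pairing σ ((StdForm.antidiagonal 3).over K) (f b i) (f b i)) = pairing σ ((StdForm.antidiagonal 3).over K) (f b i) (f b i) :=
    fun i => σ_pairing_eq hσ hHh (f b i) (f b i)
  have hn : ∀ i : Fin 3, ∃ n : ℤ, Valued.v (pairing σ ((StdForm.antidiagonal 3).over K) (f b i) (f b i)) = WithZero.exp (2 * n) := fun i =>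
    heven _ (hNσ i) (hN0 i)
  choose n hn using hn
  -- the frame matrix `Q` and the rescaling `C = diag(ϖ^{n_i})`
  set Q : GL (Fin 3) K := ((Matrix.isUnit_iff_isUnit_det _).2 (isUnit_det_frameMatrix hf b)).unit with hQ_def
  have hQ : (Q : Matrix (Fin 3) (Fin 3) K) = (Matrix.of (f b))ᵀ := rfl
  have hc0 : ∀ i : Fin 3, (ϖ ^ (n i) : K) ≠ 0 := fun i => zpow_ne_zero _ hϖ0
  let C : GL (Fin 3) K :=
    ⟨Matrix.diagonal fun i => (ϖ ^ (n i) : K), Matrix.diagonal fun i => (ϖ ^ (n i) : K)⁻¹,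
      by rw [Matrix.diagonal_mul_diagonal, ← Matrix.diagonal_one]; congr 1; funext i; exact mul_inv_cancel₀ (hc0 i),
      by rw [Matrix.diagonal_mul_diagonal, ← Matrix.diagonal_one]; congr 1; funext i; exact inv_mul_cancel₀ (hc0 i)⟩
  have hC : (C : Matrix (Fin 3) (Fin 3) K) = Matrix.diagonal fun i => (ϖ ^ (n i) : K) := rfl
  have hCinv : ((C⁻¹ : GL (Fin 3) K) : Matrix (Fin 3) (Fin 3) K) = Matrix.diagonal fun i => (ϖ ^ (n i) : K)⁻¹ := rfl
  refine ⟨Q * C, fun i => σ (ϖ ^ (n i)) * pairing σ ((StdForm.antidiagonal 3).over K) (f b i) (f b i) * ϖ ^ (n i),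
    fun i => ?_, fun i => ?_, fun i => ?_, ?_, fun α β => ?_⟩
  · -- `|σ(ϖ^{n}) N ϖ^{n}| = exp(-n) exp(2n) exp(-n) = 1`
    rw [map_mul, map_mul, hvσ, CartanUnique.v_uniformizer_zpow hϖ, hn i, ← WithZero.exp_add, ← WithZero.exp_add, ← WithZero.exp_zero]
    congr 1; ring
  · -- `σ`-fixed: `σ(σ(ϖ^n) N ϖ^n) = ϖ^n N σ(ϖ^n)`
    rw [map_mul, map_mul, hσ, hNσ i]
    ring
  · -- norm class: `d_i = N_i · (ϖ^n σ(ϖ^n))`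
    dsimp only
    rw [show σ (ϖ ^ (n i)) * pairing σ ((StdForm.antidiagonal 3).over K) (f b i) (f b i) * ϖ ^ (n i) =
        pairing σ ((StdForm.antidiagonal 3).over K) (f b i) (f b i) * (ϖ ^ (n i) * σ (ϖ ^ (n i))) by ring]
    exact normSign_mul_norm σ _ (hc0 i)
  · rw [formCongr_mul_eq, formCongr_frameMatrix hf b Q hQ, formCongr, hC, Matrix.diagonal_map (map_zero σ), Matrix.diagonal_transpose,
      Matrix.diagonal_mul_diagonal, Matrix.diagonal_mul_diagonal]
  · rw [frameElt_eq_conj_diagonal hf b α β Q hQ, _root_.mul_inv_rev, Units.val_mul, Units.val_mul, hC, hCinv]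
    simp only [Matrix.mul_assoc]
    congr 1
    rw [← Matrix.mul_assoc (Matrix.diagonal ![α, β, 1]), Matrix.diagonal_mul_diagonal, ← Matrix.mul_assoc, Matrix.diagonal_mul_diagonal]
    congr 2
    funext i
    rw [mul_left_comm, mul_inv_cancel₀ (hc0 i), mul_one]

/-- **HEAD — THE FOUR-FRAME CENSUS IN THE UNIMODULAR DIAGONAL MODEL, BOTH VERTEX TYPES.**  Under the datum clauses (`σ` an isometric involution, `|ϖ| = exp(−1)`, non-zero
`σ`-fixed elements of even valuation), for a four-frame family `f` and a frame `b` there is a unit diagonal form `h_d = diag(d)` — `|d_i| = 1`, `σ d_i = d_i`, `ω(d_i) = ω(N_i)`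
(so `(ω(d₁), ω(d₂)) = signPair b` by ★ #0a H7) — such that for ALL `α, β`, every `T ∈ GL₃` with matrix `diag(α, β, 1)` and every `Γ ∈ GL₃` with matrix `frameElt σ f b α β`:
`fixedVertexCount σ ϖ t Γ = #{M : M a type-t vertex lattice of (K³, h_d), T·M = M}` for every `t` (types `0` and `2` alike).  Step (1) of the (S) reduction.
[cite: Rogawski1990, §4.9 Prop. 4.9.1 (a) p. 55] [cite: Kottwitz1986BaseChangeUnits, §1 pp. 240–241] [cite: BruhatTits1972, §10] -/
theorem fixedVertexCount_frameElt_eq_ncard_diagonal_model (hσ : ∀ x, σ (σ x) = x) (hvσ : ∀ a, Valued.v (σ a) = Valued.v a)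
    (hϖ : Valued.v ϖ = WithZero.exp (-1 : ℤ)) (heven : ∀ x : K, σ x = x → x ≠ 0 → ∃ n : ℤ, Valued.v x = WithZero.exp (2 * n))
    {f : Fin 4 → Fin 3 → (Fin 3 → K)} (hf : IsFourFrameFamily σ f) (b : Fin 4) :
    ∃ d : Fin 3 → K, (∀ i, Valued.v (d i) = 1) ∧ (∀ i, σ (d i) = d i) ∧
      (∀ i, normSign σ (d i) = normSign σ (pairing σ ((StdForm.antidiagonal 3).over K) (f b i) (f b i))) ∧
      ∀ (α β : K) (T Γ : GL (Fin 3) K), (T : Matrix (Fin 3) (Fin 3) K) = Matrix.diagonal ![α, β, 1] →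
        (Γ : Matrix (Fin 3) (Fin 3) K) = frameElt σ f b α β →
        ∀ t : ℕ, fixedVertexCount σ ϖ t Γ =
          {M : Submodule 𝒪[K] (Fin 3 → K) | IsVertexLattice σ ϖ (Matrix.diagonal d) t M ∧ mapGL T M = M}.ncard := by
  obtain ⟨A, d, hd, hσd, hcls, hA, hconj⟩ := exists_unimodular_diagonal_frame hσ hvσ hϖ heven hf b
  refine ⟨d, hd, hσd, hcls, fun α β T Γ hT hΓ t => ?_⟩
  have hΓ' : Γ = A * T * A⁻¹ := Units.ext (by rw [hΓ, hconj α β, Units.val_mul, Units.val_mul, hT])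
  rw [fixedVertexCount, hΓ', ← hA]
  exact (ncard_fixed_formCongr_eq σ ϖ ((StdForm.antidiagonal 3).over K) A T t).symm

end Frame

/-! ## §4  The model count depends on `d` only through the norm classes of its entries -/

section Classes

variable {K : Type*} [Field K] [Valued K ℤᵐ⁰] {N : ℕ}

/-- **(C) CLASS-ONLY DEPENDENCE.**  If two diagonal forms `diag(d)`, `diag(d′)` differ entrywise by norms — `σ(z_i)·d_i·z_i = d′_i` with `z_i ≠ 0` — then for every DIAGONAL
`T = diag(s)` the type-`t` fixed counts agree: `diag(z)` is a congruence `ᵗσ(diag z)·diag(d)·diag(z) = diag(d′)` commuting with `T` (§1 (T)).  In the four-frame census: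
the count of a frame depends only on its norm classes `(ε₁, ε₂, ε₃)`. [cite: Jacobowitz1962, §4] [cite: BruhatTits1972, §10] -/
theorem ncard_fixed_diagonal_eq_of_exists_norm (σ : K →+* K) (ϖ : K) {d d' : Fin N → K} (h : ∀ i, ∃ z : K, z ≠ 0 ∧ σ z * d i * z = d' i)
    (s : Fin N → K) (T : GL (Fin N) K) (hT : (T : Matrix (Fin N) (Fin N) K) = Matrix.diagonal s) (t : ℕ) :
    {M : Submodule 𝒪[K] (Fin N → K) | IsVertexLattice σ ϖ (Matrix.diagonal d') t M ∧ mapGL T M = M}.ncard =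
      {M : Submodule 𝒪[K] (Fin N → K) | IsVertexLattice σ ϖ (Matrix.diagonal d) t M ∧ mapGL T M = M}.ncard := by
  classical
  choose z hz0 hz using h
  let P : GL (Fin N) K :=
    ⟨Matrix.diagonal z, Matrix.diagonal fun i => (z i)⁻¹,
      by rw [Matrix.diagonal_mul_diagonal, ← Matrix.diagonal_one]; congr 1; funext i; exact mul_inv_cancel₀ (hz0 i),
      by rw [Matrix.diagonal_mul_diagonal, ← Matrix.diagonal_one]; congr 1; funext i; exact inv_mul_cancel₀ (hz0 i)⟩
  have hP : (P : Matrix (Fin N) (Fin N) K) = Matrix.diagonal z := rfl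
  have hPinv : ((P⁻¹ : GL (Fin N) K) : Matrix (Fin N) (Fin N) K) = Matrix.diagonal fun i => (z i)⁻¹ := rfl
  have hform : formCongr σ P (Matrix.diagonal d) = Matrix.diagonal d' := by
    rw [formCongr, hP, Matrix.diagonal_map (map_zero σ), Matrix.diagonal_transpose, Matrix.diagonal_mul_diagonal, Matrix.diagonal_mul_diagonal]
    congr 1; funext i; exact hz i
  have hcomm : P * T * P⁻¹ = T := Units.ext (by
    rw [Units.val_mul, Units.val_mul, hP, hT, hPinv, Matrix.diagonal_mul_diagonal, Matrix.diagonal_mul_diagonal]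
    congr 1; funext i; rw [mul_comm (z i) (s i), mul_inv_cancel_right₀ (hz0 i)])
  rw [← hform, ncard_fixed_formCongr_eq σ ϖ (Matrix.diagonal d) P T t, hcomm]

end Classes

end Summit.HodgeConjecture.HodgeConjecture.Cruxes.H413.F0P3cDyRamFixedCountDiagonalModel

end
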